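import Summits.ValiantsHypothesis.ValiantsHypothesis.Theorems.LacunarySymmetroidMatrixDescartesFiniteSectorIterMasks

/-!
# `MatrixDescartes` — line «finite»: the SIEVE-CAP WITNESS at the cell `(22,5)` — Conjecture Σ fails there (kernel bit facts)

HONEST FRAMING.  Object-search cell `pub-symmetroid`, seat val-sym-door-p5 g13.  HELPER of the crux item `stmt-ValiantsHypothesis-18050`
(`Theses.LacunarySymmetroid.MatrixDescartes`) with NO closure claim and no statement about pencils: four kernel-decided BIT FACTS about the
`22`-fold sum masks (the iterated shift-or masks of `…FiniteSectorIterMasks`, whose set bits contain every `22`-fold sum of the listed values by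
`testBit_iterMask_of_multiset'`) of two supports, recording in the kernel the located finding of this seat (evidence #50 on the item,
`SIGMA-VIOLATION-22-5-g13.md`): Conjecture Σ of `Cruxes/MatrixDescartes/Lines/finite.md` — «the sieve cap `σ(m,K)` equals `2·n(m,K−1)`» — FAILS at
`(22,5)`.  For the MIXED-PARITY support `E* = {0,2,35,224,1283}` the mask has bit `8783` set and, below `8784`, never two consecutive clear bits
(`sieveWitness_twentytwo_five_top`, `…_alive`), and bits `8784`, `8785` clear (`…_dies`): in the walker's own currency the step-≤-2 chain of the SIEVE
(`FiniteSector.sieve`, `natDegree_mem_sumset`) is consistent with degree `8783` on `E*` and with nothing larger, so the sieve cannot certify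
`HypRootLawAt 22 5 B` for any `B < 8783`; the companion cell `…FiniteSectorSectorCeilingTwentytwoFive` certifies `HypRootLawAt 22 5 8783`, so the sieve
cap is exactly `σ(22,5) = 8783`.  For the doubled extremal stamp basis `2·{0,1,12,121,561}` (`n(22,4) = 4368`, `…StampCeilingTwentytwoFive`) bits `8737` and
`8738` are clear (`doubledBasis_twentytwo_five_dies`), so its chain caps at `2·n(22,4) = 8736 < 8783`.  Located first by exact DFS (one violation at
`8736`, none at `8783`, unique survivor `E*`); the neighbouring cells `(20,5)`, `(21,5)`, `(23,5)`, `(24,5)`, `(25,5)` conform to Σ.  NOT CLAIMED: any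
`η` lower side (whether a symmetric `22 × 22` pencil on `E*` realises a real-rooted-simple determinant of degree `> 8736` is open), anything asymptotic,
anything about the doors or `VP ≠ VNP`.
[folklore] Elementary bit arithmetic decided in the kernel; no citation is load-bearing.
-/

-- `Summit.ValiantsHypothesis.ValiantsHypothesis.…` repeats a component by the D-0017 layout
-- (single-conjunct summit), which the `dupNamespace` linter flags; the name is mandated.
set_option linter.dupNamespace false

namespace Summit.ValiantsHypothesis.ValiantsHypothesis.Theorems.LacunarySymmetroidMatrixDescartes.FiniteSector

set_option maxRecDepth 100000 in
/-- **Top of the chain on `E* = {0,2,35,224,1283}`:** bit `8783` of the `22`-fold sum mask is set (indeed `8783` is a `22`-fold sum of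
values of `E*`; the mask over-approximates nothing: it is the exact indicator of `22`-fold sums, cf. `testBit_iterMask_of_multiset'`). [folklore] -/
theorem sieveWitness_twentytwo_five_top :
    (((fun (E : ℕ) => @List.rec ℕ (fun _ => ℕ) 0 (fun (x : ℕ) (_ : List ℕ) (acc : ℕ) => Nat.lor acc (Nat.shiftLeft E x)) [0, 2, 35, 224, 1283]))^[22] 1).testBit 8783 = true := by
  decide +kernel

set_option maxRecDepth 100000 in
/-- **The chain on `E*` is alive below `8784`:** no two consecutive clear bits of the `22`-fold sum mask below `8784` — the hypothesis shape of
`rawAlive_of_testBit` / `maskAlive_of_testBit'` at `t = 8784`. [folklore] -/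
theorem sieveWitness_twentytwo_five_alive :
    ∀ r < 8784, (((fun (E : ℕ) => @List.rec ℕ (fun _ => ℕ) 0 (fun (x : ℕ) (_ : List ℕ) (acc : ℕ) => Nat.lor acc (Nat.shiftLeft E x)) [0, 2, 35, 224, 1283]))^[22] 1).testBit r = true ∨
      (((fun (E : ℕ) => @List.rec ℕ (fun _ => ℕ) 0 (fun (x : ℕ) (_ : List ℕ) (acc : ℕ) => Nat.lor acc (Nat.shiftLeft E x)) [0, 2, 35, 224, 1283]))^[22] 1).testBit (r + 1) = true := by
  decide +kernel

set_option maxRecDepth 100000 in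
/-- **The chain on `E*` dies at `8784`:** bits `8784` and `8785` of the `22`-fold sum mask are clear, so no step-≤-2 chain inside the mask passes
`8783`. [folklore] -/
theorem sieveWitness_twentytwo_five_dies :
    (((fun (E : ℕ) => @List.rec ℕ (fun _ => ℕ) 0 (fun (x : ℕ) (_ : List ℕ) (acc : ℕ) => Nat.lor acc (Nat.shiftLeft E x)) [0, 2, 35, 224, 1283]))^[22] 1).testBit 8784 = false ∧
      (((fun (E : ℕ) => @List.rec ℕ (fun _ => ℕ) 0 (fun (x : ℕ) (_ : List ℕ) (acc : ℕ) => Nat.lor acc (Nat.shiftLeft E x)) [0, 2, 35, 224, 1283]))^[22] 1).testBit 8785 = false := by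
  decide +kernel

set_option maxRecDepth 100000 in
/-- **The doubled extremal stamp basis `2·{0,1,12,121,561}` dies at `8737`:** bits `8737` and `8738` of its `22`-fold sum mask are clear, so its
step-≤-2 chain caps at `8736 = 2·n(22,4)` — `47` below the mixed-parity support `E*`. [folklore] -/
theorem doubledBasis_twentytwo_five_dies :
    (((fun (E : ℕ) => @List.rec ℕ (fun _ => ℕ) 0 (fun (x : ℕ) (_ : List ℕ) (acc : ℕ) => Nat.lor acc (Nat.shiftLeft E x)) [0, 2, 24, 242, 1122]))^[22] 1).testBit 8737 = false ∧
      (((fun (E : ℕ) => @List.rec ℕ (fun _ => ℕ) 0 (fun (x : ℕ) (_ : List ℕ) (acc : ℕ) => Nat.lor acc (Nat.shiftLeft E x)) [0, 2, 24, 242, 1122]))^[22] 1).testBit 8738 = false := by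
  decide +kernel

end Summit.ValiantsHypothesis.ValiantsHypothesis.Theorems.LacunarySymmetroidMatrixDescartes.FiniteSector
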